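import Literature.NumberTheory.Sieve.LinearEquationsInPrimesNormalForm
import HarnessLib

/-!
# Linear equations in primes: crude bounds for the archimedean reduction (Green–Tao 2010, §4)

Trunk T-SIEVE (`Literature/NumberTheory/Sieve`). B. Green, T. Tao, *Linear equations in primes*,
Ann. of Math. 171 (2010), §4, "Elimination of the archimedean factor": "Clearly we may intersect
`K` with the convex set `Ψ⁻¹((ℝ⁺)ᵗ)` and reduce to the case where `ψᵢ > 0` on `K`; in this
case `β_∞` is simply the volume of `K`. … It turns out to be convenient to strengthen the
condition `ψᵢ > 0` slightly, say to `ψᵢ > N^{9/10}`. … One can easily verify, by estimating `Λ`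
crudely by `log N`, that for each `i` the contribution of the case `0 ≤ ψᵢ(n) ≤ N^{9/10}` to
(4.2) is `o(N^d)`." This file proves the elementary estimates behind these two sentences (all
proved, no named facts):

* `Literature.posBody Ψ c K = K ∩ {x : ψᵢ(x) > c ∀ i}` — convex (`convex_posBody`), and
  `archFactor Ψ K = vol (posBody Ψ 0 K)` (`archFactor_eq_volume_posBody`);
* `Literature.NumberTheory.Sieve.card_filter_eval_eq_le` — a non-constant form takes each value at most `(2N+1)^{d-1}`
  times on `[-N,N]^d ∩ ℤ^d`, hence (`card_filter_eval_mem_Icc_le`) lies in a window of `H`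
  consecutive values at most `H (2N+1)^{d-1}` times;
* `Literature.NumberTheory.Sieve.abs_eval_le_of_affLinSize_le` — `|ψᵢ(n)| ≤ 2LN` on the box when `‖Ψ‖_N ≤ L`, and
  `Literature.NumberTheory.Sieve.prod_intVonMangoldt_le` — "estimating `Λ` crudely by `log N`":
  `0 ≤ ∏ᵢ Λ(ψᵢ(n)) ≤ log^t(2LN)`;
* `Literature.NumberTheory.Sieve.vonMangoldtSum_sub_posBody_le` — the contribution of `{n : some 0 < ψᵢ(n) ≤ H}` to the
  von Mangoldt sum is at most `t H (2N+1)^{d-1} log^t(2LN)`;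
* `Literature.NumberTheory.Sieve.latticePointCount_posBody_le` — and to the lattice point count of `posBody Ψ 0 K` at
  most `t H (2N+1)^{d-1}`.

## References

* B. Green, T. Tao, *Linear equations in primes*, Ann. of Math. (2) 171 (2010), 1753–1850
  (arXiv:math/0606088): §4, "Elimination of the archimedean factor" and Thm. 4.1; (1.2), (1.4).
-/

noncomputable section

open Finset MeasureTheory

namespace Literature.NumberTheory.Sieve

variable {d t : ℕ}

/-! ### The positive part of a body -/

/-- `K ∩ {x : ψᵢ(x) > c for all i}`; for `c = 0` this is `K ∩ Ψ⁻¹((ℝ⁺)ᵗ)`, for `c = N^{9/10}`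
the body of Thm. 4.1. [cite: GreenTao2010, §4 (Elimination of the archimedean factor)] -/
def posBody (Ψ : Fin t → AffLinForm d) (c : ℝ) (K : Set (Fin d → ℝ)) : Set (Fin d → ℝ) :=
  K ∩ {x | ∀ i, c < (Ψ i).realEval x}

/-- `posBody Ψ c K ⊆ K`. [folklore] -/
theorem posBody_subset (Ψ : Fin t → AffLinForm d) (c : ℝ) (K : Set (Fin d → ℝ)) :
    posBody Ψ c K ⊆ K :=
  Set.inter_subset_left

/-- Monotonicity in the threshold. [folklore] -/
theorem posBody_mono (Ψ : Fin t → AffLinForm d) {c c' : ℝ} (h : c ≤ c') (K : Set (Fin d → ℝ)) :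
    posBody Ψ c' K ⊆ posBody Ψ c K :=
  fun _ hx => ⟨hx.1, fun i => lt_of_le_of_lt h (hx.2 i)⟩

/-- The forms are `> c` on `posBody Ψ c K`. [folklore] -/
theorem realEval_gt_of_mem_posBody {Ψ : Fin t → AffLinForm d} {c : ℝ} {K : Set (Fin d → ℝ)}
    {x : Fin d → ℝ} (hx : x ∈ posBody Ψ c K) (i : Fin t) : c < (Ψ i).realEval x :=
  hx.2 i

/-- The linear part of the real extension is a linear map. [folklore] -/
theorem AffLinForm.isLinearMap_realLinearPart (ψ : AffLinForm d) :
    IsLinearMap ℝ fun x : Fin d → ℝ => ∑ j, (ψ.coeff j : ℝ) * x j := by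
  constructor
  · intro x y
    simp only [Pi.add_apply, mul_add, Finset.sum_add_distrib]
  · intro c x
    simp only [Pi.smul_apply, smul_eq_mul, Finset.mul_sum]
    exact Finset.sum_congr rfl fun j _ => by ring

/-- The super-level sets `{x : ψ(x) > c}` of an affine-linear form are convex. [folklore] -/
theorem AffLinForm.convex_realEval_gt (ψ : AffLinForm d) (c : ℝ) :
    Convex ℝ {x : Fin d → ℝ | c < ψ.realEval x} := by
  have : {x : Fin d → ℝ | c < ψ.realEval x} =
      {x : Fin d → ℝ | c - ψ.const < ∑ j, (ψ.coeff j : ℝ) * x j} := by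
    ext x
    simp only [Set.mem_setOf_eq, AffLinForm.realEval]
    constructor <;> intro h <;> linarith
  rw [this]
  exact convex_halfSpace_gt ψ.isLinearMap_realLinearPart _

/-- `posBody Ψ c K` is convex if `K` is ("intersect `K` with the convex set `Ψ⁻¹((ℝ⁺)ᵗ)`").
[cite: GreenTao2010, §4 (Elimination of the archimedean factor)] -/
theorem convex_posBody (Ψ : Fin t → AffLinForm d) (c : ℝ) {K : Set (Fin d → ℝ)} (hK : Convex ℝ K) :
    Convex ℝ (posBody Ψ c K) := by
  have : {x : Fin d → ℝ | ∀ i, c < (Ψ i).realEval x} = ⋂ i, {x | c < (Ψ i).realEval x} := by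
    ext x; simp
  unfold posBody
  rw [this]
  exact hK.inter (convex_iInter fun i => (Ψ i).convex_realEval_gt c)

/-- "`β_∞` is simply the volume of `K`" (after intersecting with `Ψ⁻¹((ℝ⁺)ᵗ)`):
`archFactor Ψ K = vol (posBody Ψ 0 K)`. [cite: GreenTao2010, (1.4) and §4] -/
theorem archFactor_eq_volume_posBody (Ψ : Fin t → AffLinForm d) (K : Set (Fin d → ℝ)) :
    archFactor Ψ K = (volume (posBody Ψ 0 K)).toReal := rfl

/-! ### Values of a form on the box -/

/-- A non-constant form takes each value at most `(2N+1)^{d-1}` times on `[-N,N]^d ∩ ℤ^d`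
(project along a coordinate with non-zero coefficient). [folklore] -/
theorem card_filter_eval_eq_le (ψ : AffLinForm d) {j : Fin d} (hj : ψ.coeff j ≠ 0) (N : ℕ)
    (v : ℤ) : #{n ∈ latticeBox d N | ψ.eval n = v} ≤ (2 * N + 1) ^ (d - 1) := by
  classical
  let g : Fin d → Finset ℤ := fun _ => Finset.Icc (-(N : ℤ)) N
  let T : Finset (Fin d → ℤ) := Fintype.piFinset (Function.update g j {0})
  have hT : #T = (2 * N + 1) ^ (d - 1) := by
    have h1 : ((N : ℤ) + 1 - -(N : ℤ)) = ((2 * N + 1 : ℕ) : ℤ) := by push_cast; ring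
    have hgi : ∀ i, #(Function.update g j {0} i) = Function.update (fun _ : Fin d => 2 * N + 1) j 1 i := by
      intro i
      by_cases hi : i = j
      · subst hi; simp
      · simp only [Function.update_of_ne hi, g, Int.card_Icc, h1, Int.toNat_natCast]
    simp only [T, Fintype.card_piFinset, hgi]
    rw [Finset.prod_update_of_mem (Finset.mem_univ j), one_mul, Finset.prod_const]
    congr 1
    rw [Finset.card_sdiff_of_subset (by simp), Finset.card_univ, Fintype.card_fin, Finset.card_singleton]
  rw [← hT]
  refine Finset.card_le_card_of_injOn (fun n => Function.update n j 0) (fun n hn => ?_) ?_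
  · -- maps into `T`
    have hn' := (Finset.mem_filter.mp (Finset.mem_coe.mp hn)).1
    refine Finset.mem_coe.mpr (Fintype.mem_piFinset.mpr fun i => ?_)
    by_cases hi : i = j
    · subst hi; simp
    · show Function.update n j 0 i ∈ Function.update g j {0} i
      rw [Function.update_of_ne hi, Function.update_of_ne hi]
      exact Fintype.mem_piFinset.mp hn' i
  · -- injective on the fibre `{ψ = v}`
    intro n hn n' hn' h
    have hv : ψ.eval n = ψ.eval n' := by
      rw [(Finset.mem_filter.mp (Finset.mem_coe.mp hn)).2,
        (Finset.mem_filter.mp (Finset.mem_coe.mp hn')).2]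
    have hoff : ∀ i, i ≠ j → n i = n' i := fun i hi => by
      have : Function.update n j 0 i = Function.update n' j 0 i := congr_fun h i
      rwa [Function.update_of_ne hi, Function.update_of_ne hi] at this
    have hsum : ∀ m : Fin d → ℤ, ψ.eval m =
        ψ.coeff j * m j + (∑ i ∈ Finset.univ.erase j, ψ.coeff i * m i + ψ.const) := fun m => by
      rw [AffLinForm.eval, ← Finset.add_sum_erase _ _ (Finset.mem_univ j), add_assoc]
    have hrest : ∑ i ∈ Finset.univ.erase j, ψ.coeff i * n i =
        ∑ i ∈ Finset.univ.erase j, ψ.coeff i * n' i :=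
      Finset.sum_congr rfl fun i hi => by rw [hoff i (Finset.ne_of_mem_erase hi)]
    rw [hsum n, hsum n', hrest, add_left_inj] at hv
    have hj' : n j = n' j := mul_left_cancel₀ hj hv
    funext i
    by_cases hi : i = j
    · subst hi; exact hj'
    · exact hoff i hi

/-- Hence a non-constant form lies in a window `(a, a + H]` of `H` consecutive values at most
`H (2N+1)^{d-1}` times on the box. [folklore] -/
theorem card_filter_eval_mem_Icc_le (ψ : AffLinForm d) {j : Fin d} (hj : ψ.coeff j ≠ 0) (N : ℕ)
    (a : ℤ) (H : ℕ) :
    #{n ∈ latticeBox d N | ψ.eval n ∈ Finset.Icc (a + 1) (a + H)} ≤ H * (2 * N + 1) ^ (d - 1) := by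
  classical
  have hset : ({n ∈ latticeBox d N | ψ.eval n ∈ Finset.Icc (a + 1) (a + H)} : Finset _) =
      (Finset.Icc (a + 1) (a + H)).biUnion fun v => {n ∈ latticeBox d N | ψ.eval n = v} := by
    ext n
    simp only [Finset.mem_filter, Finset.mem_biUnion]
    constructor
    · rintro ⟨h1, h2⟩; exact ⟨_, h2, h1, rfl⟩
    · rintro ⟨v, hv, h1, rfl⟩; exact ⟨h1, hv⟩
  rw [hset]
  calc #((Finset.Icc (a + 1) (a + H)).biUnion fun v => {n ∈ latticeBox d N | ψ.eval n = v})
      ≤ ∑ v ∈ Finset.Icc (a + 1) (a + H), #{n ∈ latticeBox d N | ψ.eval n = v} :=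
        Finset.card_biUnion_le
    _ ≤ ∑ _v ∈ Finset.Icc (a + 1) (a + H), (2 * N + 1) ^ (d - 1) :=
        Finset.sum_le_sum fun v _ => card_filter_eval_eq_le ψ hj N v
    _ = H * (2 * N + 1) ^ (d - 1) := by
        rw [Finset.sum_const, Int.card_Icc, smul_eq_mul]
        congr 1
        omega

/-- Every form of a non-degenerate system has a non-zero coefficient. [cite: GreenTao2010, Def. 1.1] -/
theorem exists_coeff_ne_zero {Ψ : Fin t → AffLinForm d} (hΨ : IsNondegenerateSystem Ψ) (i : Fin t) :
    ∃ j, (Ψ i).coeff j ≠ 0 := by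
  by_contra h
  push Not at h
  exact hΨ.1 i (funext h)

/-! ### Crude bounds for `Λ` on the box -/

/-- On the box, `|ψᵢ(n)| ≤ 2LN` when `‖Ψ‖_N ≤ L` (`∑ⱼ |ψ̇ᵢ(eⱼ)| ≤ L`, `|ψᵢ(0)| ≤ LN`).
[cite: GreenTao2010, (1.1)] -/
theorem abs_eval_le_of_affLinSize_le {Ψ : Fin t → AffLinForm d} {N : ℕ} {L : ℝ} (hN : 1 ≤ N)
    (hL : affLinSize Ψ N ≤ L) {n : Fin d → ℤ} (hn : n ∈ latticeBox d N) (i : Fin t) :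
    |((Ψ i).eval n : ℝ)| ≤ 2 * L * N := by
  have hN0 : (0 : ℝ) < N := by exact_mod_cast hN
  have hnj : ∀ j, |(n j : ℝ)| ≤ N := fun j => by
    have := Finset.mem_Icc.mp (Fintype.mem_piFinset.mp hn j)
    rw [← Int.cast_abs]
    exact_mod_cast abs_le.mpr this
  -- the two parts of `‖Ψ‖_N`
  have h1 : ∑ j, |((Ψ i).coeff j : ℝ)| ≤ L := by
    have ha : ∑ j, |((Ψ i).coeff j : ℝ)| ≤ ∑ i', ∑ j, |((Ψ i').coeff j : ℝ)| :=
      Finset.single_le_sum (f := fun i' => ∑ j, |((Ψ i').coeff j : ℝ)|)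
        (fun _ _ => Finset.sum_nonneg fun _ _ => abs_nonneg _) (Finset.mem_univ i)
    have hb : ∑ i', ∑ j, |((Ψ i').coeff j : ℝ)| ≤ affLinSize Ψ N :=
      le_add_of_nonneg_right (Finset.sum_nonneg fun _ _ => abs_nonneg _)
    linarith
  have h2 : |((Ψ i).const : ℝ)| ≤ L * N := by
    have ha : |((Ψ i).const : ℝ) / N| ≤ ∑ i', |((Ψ i').const : ℝ) / N| :=
      Finset.single_le_sum (f := fun i' => |((Ψ i').const : ℝ) / N|) (fun _ _ => abs_nonneg _)
        (Finset.mem_univ i)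
    have hb : ∑ i', |((Ψ i').const : ℝ) / N| ≤ affLinSize Ψ N :=
      le_add_of_nonneg_left (Finset.sum_nonneg fun _ _ => Finset.sum_nonneg fun _ _ => abs_nonneg _)
    have : |((Ψ i).const : ℝ) / N| ≤ L := by linarith
    rwa [abs_div, abs_of_pos hN0, div_le_iff₀ hN0] at this
  have h3 : |(∑ j, ((Ψ i).coeff j : ℝ) * n j)| ≤ L * N := by
    calc |∑ j, ((Ψ i).coeff j : ℝ) * n j| ≤ ∑ j, |((Ψ i).coeff j : ℝ) * n j| :=
          Finset.abs_sum_le_sum_abs _ _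
      _ ≤ ∑ j, |((Ψ i).coeff j : ℝ)| * N := Finset.sum_le_sum fun j _ => by
          rw [abs_mul]
          exact mul_le_mul_of_nonneg_left (hnj j) (abs_nonneg _)
      _ = (∑ j, |((Ψ i).coeff j : ℝ)|) * N := (Finset.sum_mul _ _ _).symm
      _ ≤ L * N := mul_le_mul_of_nonneg_right h1 hN0.le
  have heval : ((Ψ i).eval n : ℝ) = ∑ j, ((Ψ i).coeff j : ℝ) * n j + (Ψ i).const := by
    simp [AffLinForm.eval]
  rw [heval]
  calc |∑ j, ((Ψ i).coeff j : ℝ) * n j + ((Ψ i).const : ℝ)|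
      ≤ |∑ j, ((Ψ i).coeff j : ℝ) * n j| + |((Ψ i).const : ℝ)| := abs_add_le _ _
    _ ≤ L * N + L * N := add_le_add h3 h2
    _ = 2 * L * N := by ring

/-- `Λ` on `ℤ` is non-negative. [folklore] -/
theorem intVonMangoldt_nonneg (m : ℤ) : 0 ≤ intVonMangoldt m :=
  ArithmeticFunction.vonMangoldt_nonneg

/-- `Λ(m) ≤ log M` for `m ≤ M`, `1 ≤ M` ("estimating `Λ` crudely by `log N`"). [folklore] -/
theorem intVonMangoldt_le_log {m : ℤ} {M : ℝ} (hM : 1 ≤ M) (hm : (m : ℝ) ≤ M) :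
    intVonMangoldt m ≤ Real.log M := by
  unfold intVonMangoldt
  rcases Nat.eq_zero_or_pos m.toNat with h0 | hpos
  · rw [h0, ArithmeticFunction.map_zero]
    exact Real.log_nonneg hM
  · refine ArithmeticFunction.vonMangoldt_le_log.trans (Real.log_le_log (by exact_mod_cast hpos) ?_)
    have : ((m.toNat : ℕ) : ℝ) = (m : ℝ) := by
      have hm0 : 0 ≤ m := by
        by_contra hh
        push Not at hh
        rw [Int.toNat_eq_zero.mpr hh.le] at hpos
        exact lt_irrefl 0 hpos
      exact_mod_cast Int.toNat_of_nonneg hm0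
    rw [this]
    exact hm

/-- **"Estimating `Λ` crudely by `log N`"**: on the box, `0 ≤ ∏ᵢ Λ(ψᵢ(n)) ≤ log^t(2LN)` when
`‖Ψ‖_N ≤ L`, `L, N ≥ 1`. [cite: GreenTao2010, §4 (Elimination of the archimedean factor)] -/
theorem prod_intVonMangoldt_le {Ψ : Fin t → AffLinForm d} {N : ℕ} {L : ℝ} (hN : 1 ≤ N) (hL1 : 1 ≤ L)
    (hL : affLinSize Ψ N ≤ L) {n : Fin d → ℤ} (hn : n ∈ latticeBox d N) :
    0 ≤ ∏ i, intVonMangoldt ((Ψ i).eval n) ∧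
      ∏ i, intVonMangoldt ((Ψ i).eval n) ≤ Real.log (2 * L * N) ^ t := by
  have hM : (1 : ℝ) ≤ 2 * L * N := by
    have : (1 : ℝ) ≤ N := by exact_mod_cast hN
    nlinarith
  refine ⟨Finset.prod_nonneg fun i _ => intVonMangoldt_nonneg _, ?_⟩
  calc ∏ i, intVonMangoldt ((Ψ i).eval n) ≤ ∏ _i : Fin t, Real.log (2 * L * N) :=
        Finset.prod_le_prod (fun i _ => intVonMangoldt_nonneg _) fun i _ =>
          intVonMangoldt_le_log hM ((le_abs_self _).trans (abs_eval_le_of_affLinSize_le hN hL hn i))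
    _ = Real.log (2 * L * N) ^ t := by rw [Finset.prod_const, Finset.card_univ, Fintype.card_fin]

/-- A factor `Λ(ψᵢ(n))` with `ψᵢ(n) ≤ 0` kills the product. [folklore] -/
theorem prod_intVonMangoldt_eq_zero {Ψ : Fin t → AffLinForm d} {n : Fin d → ℤ} {i : Fin t}
    (hi : (Ψ i).eval n ≤ 0) : ∏ i, intVonMangoldt ((Ψ i).eval n) = 0 := by
  refine Finset.prod_eq_zero (Finset.mem_univ i) ?_
  unfold intVonMangoldt
  rw [Int.toNat_eq_zero.mpr hi, ArithmeticFunction.map_zero]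

/-! ### The contribution of `0 < ψᵢ ≤ H` -/

/-- Real points of lattice points and `realEval`. [folklore] -/
theorem realEval_realPoint (ψ : AffLinForm d) (n : Fin d → ℤ) :
    ψ.realEval (realPoint n) = (ψ.eval n : ℝ) :=
  ψ.realEval_intCast n

open Classical in
/-- **The contribution of `{n : 0 < ψᵢ(n) ≤ H for some i}` to the von Mangoldt sum**
("for each `i` the contribution of the case `0 ≤ ψᵢ(n) ≤ N^{9/10}` to (4.2) is `o(N^d)`",
here for a general integer threshold `H`): for `K ⊆ [-N,N]^d`,
`0 ≤ Σ_K - Σ_{posBody Ψ H K} ≤ t · H (2N+1)^{d-1} · log^t(2LN)`.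
[cite: GreenTao2010, §4 (Elimination of the archimedean factor)] -/
theorem vonMangoldtSum_sub_posBody_le {Ψ : Fin t → AffLinForm d} (hΨ : IsNondegenerateSystem Ψ)
    {N : ℕ} {L : ℝ} (hN : 1 ≤ N) (hL1 : 1 ≤ L) (hL : affLinSize Ψ N ≤ L) (K : Set (Fin d → ℝ))
    (H : ℕ) :
    0 ≤ vonMangoldtSum Ψ K N - vonMangoldtSum Ψ (posBody Ψ H K) N ∧
      vonMangoldtSum Ψ K N - vonMangoldtSum Ψ (posBody Ψ H K) N ≤
        t * ((H : ℝ) * (2 * N + 1) ^ (d - 1)) * Real.log (2 * L * N) ^ t := by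
  set F : (Fin d → ℤ) → ℝ := fun n => ∏ i, intVonMangoldt ((Ψ i).eval n) with hF
  set A := (latticeBox d N).filter (fun n => realPoint n ∈ K) with hA
  set A' := (latticeBox d N).filter (fun n => realPoint n ∈ posBody Ψ H K) with hA'
  have hsub : A' ⊆ A := Finset.monotone_filter_right _ (fun n _ hn => posBody_subset Ψ H K hn)
  have hdiff : vonMangoldtSum Ψ K N - vonMangoldtSum Ψ (posBody Ψ H K) N = ∑ n ∈ A \ A', F n := by
    unfold vonMangoldtSum
    rw [← Finset.sum_sdiff hsub, add_sub_cancel_right]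
  rw [hdiff]
  have hFnn : ∀ n, 0 ≤ F n := fun n => Finset.prod_nonneg fun i _ => intVonMangoldt_nonneg _
  refine ⟨Finset.sum_nonneg fun n _ => hFnn n, ?_⟩
  -- windows `Sᵢ = {n ∈ box : 1 ≤ ψᵢ(n) ≤ H}`
  let S : Fin t → Finset (Fin d → ℤ) := fun i =>
    (latticeBox d N).filter fun n => (Ψ i).eval n ∈ Finset.Icc (0 + 1) (0 + (H : ℤ))
  have hS : ∀ i, (#(S i) : ℝ) ≤ (H : ℝ) * (2 * N + 1) ^ (d - 1) := fun i => by
    obtain ⟨j, hj⟩ := exists_coeff_ne_zero hΨ i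
    exact_mod_cast card_filter_eval_mem_Icc_le (Ψ i) hj N 0 H
  have hlog : 0 ≤ Real.log (2 * L * N) ^ t := by
    refine pow_nonneg (Real.log_nonneg ?_) t
    have : (1 : ℝ) ≤ N := by exact_mod_cast hN
    nlinarith
  -- pointwise: on `A \ A'`, `F n ≤ ∑ᵢ [n ∈ Sᵢ] log^t`
  have hpt : ∀ n ∈ A \ A', F n ≤ ∑ i, if n ∈ S i then Real.log (2 * L * N) ^ t else 0 := by
    intro n hn
    obtain ⟨hnA, hnA'⟩ := Finset.mem_sdiff.mp hn
    obtain ⟨hnbox, hnK⟩ := Finset.mem_filter.mp hnA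
    have hnot : ¬ ∀ i, (H : ℝ) < (Ψ i).realEval (realPoint n) := fun hall =>
      hnA' (Finset.mem_filter.mpr ⟨hnbox, hnK, hall⟩)
    push Not at hnot
    obtain ⟨i, hi⟩ := hnot
    rw [realEval_realPoint] at hi
    have hiH : (Ψ i).eval n ≤ H := by exact_mod_cast hi
    rcases le_or_gt ((Ψ i).eval n) 0 with hle | hgt
    · rw [show F n = 0 from prod_intVonMangoldt_eq_zero hle]
      exact Finset.sum_nonneg fun i _ => by split_ifs <;> positivity
    · have hmem : n ∈ S i := Finset.mem_filter.mpr ⟨hnbox, Finset.mem_Icc.mpr ⟨by omega, by omega⟩⟩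
      calc F n ≤ Real.log (2 * L * N) ^ t := (prod_intVonMangoldt_le hN hL1 hL hnbox).2
        _ = if n ∈ S i then Real.log (2 * L * N) ^ t else 0 := by rw [if_pos hmem]
        _ ≤ ∑ i', if n ∈ S i' then Real.log (2 * L * N) ^ t else 0 :=
            Finset.single_le_sum (f := fun i' => if n ∈ S i' then Real.log (2 * L * N) ^ t else 0)
              (fun i' _ => by split_ifs <;> positivity) (Finset.mem_univ i)
  calc ∑ n ∈ A \ A', F n ≤ ∑ n ∈ A \ A', ∑ i, if n ∈ S i then Real.log (2 * L * N) ^ t else 0 :=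
        Finset.sum_le_sum hpt
    _ ≤ ∑ n ∈ latticeBox d N, ∑ i, if n ∈ S i then Real.log (2 * L * N) ^ t else 0 :=
        Finset.sum_le_sum_of_subset_of_nonneg
          (fun n hn => (Finset.mem_filter.mp (Finset.mem_sdiff.mp hn).1).1)
          fun n _ _ => Finset.sum_nonneg fun i _ => by split_ifs <;> positivity
    _ = ∑ i, ∑ n ∈ latticeBox d N, if n ∈ S i then Real.log (2 * L * N) ^ t else 0 :=
        Finset.sum_comm
    _ = ∑ i, (#(S i) : ℝ) * Real.log (2 * L * N) ^ t := by
        refine Finset.sum_congr rfl fun i _ => ?_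
        rw [Finset.sum_ite, Finset.sum_const_zero, add_zero, Finset.sum_const, nsmul_eq_mul]
        congr 2
        rw [Finset.filter_mem_eq_inter, Finset.inter_eq_right.mpr]
        exact fun n hn => (Finset.mem_filter.mp hn).1
    _ ≤ ∑ _i : Fin t, ((H : ℝ) * (2 * N + 1) ^ (d - 1)) * Real.log (2 * L * N) ^ t :=
        Finset.sum_le_sum fun i _ => mul_le_mul_of_nonneg_right (hS i) hlog
    _ = t * ((H : ℝ) * (2 * N + 1) ^ (d - 1)) * Real.log (2 * L * N) ^ t := by
        rw [Finset.sum_const, Finset.card_univ, Fintype.card_fin, nsmul_eq_mul]; ring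

open Classical in
/-- **The lattice points of `posBody Ψ 0 K` not in `posBody Ψ H K`** are at most
`t · H (2N+1)^{d-1}` (some `ψᵢ(n) ∈ {1, …, H}`). [cite: GreenTao2010, §4] -/
theorem latticePointCount_posBody_le {Ψ : Fin t → AffLinForm d} (hΨ : IsNondegenerateSystem Ψ)
    (K : Set (Fin d → ℝ)) (N H : ℕ) :
    latticePointCount (posBody Ψ 0 K) N ≤
      latticePointCount (posBody Ψ H K) N + t * (H * (2 * N + 1) ^ (d - 1)) := by
  let S : Fin t → Finset (Fin d → ℤ) := fun i =>
    (latticeBox d N).filter fun n => (Ψ i).eval n ∈ Finset.Icc (0 + 1) (0 + (H : ℤ))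
  have hS : ∀ i, #(S i) ≤ H * (2 * N + 1) ^ (d - 1) := fun i => by
    obtain ⟨j, hj⟩ := exists_coeff_ne_zero hΨ i
    exact card_filter_eval_mem_Icc_le (Ψ i) hj N 0 H
  unfold latticePointCount
  have hsub : (latticeBox d N).filter (fun n => realPoint n ∈ posBody Ψ 0 K) ⊆
      (latticeBox d N).filter (fun n => realPoint n ∈ posBody Ψ H K) ∪
        Finset.univ.biUnion S := by
    intro n hn
    obtain ⟨hnbox, hnK, hpos⟩ := Finset.mem_filter.mp hn
    rw [Finset.mem_union, Finset.mem_biUnion]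
    by_cases hall : ∀ i, (H : ℝ) < (Ψ i).realEval (realPoint n)
    · exact Or.inl (Finset.mem_filter.mpr ⟨hnbox, hnK, hall⟩)
    · push Not at hall
      obtain ⟨i, hi⟩ := hall
      have h0 := hpos i
      rw [realEval_realPoint] at hi h0
      have hiH : (Ψ i).eval n ≤ H := by exact_mod_cast hi
      have hi0 : 0 < (Ψ i).eval n := by exact_mod_cast h0
      exact Or.inr ⟨i, Finset.mem_univ i,
        Finset.mem_filter.mpr ⟨hnbox, Finset.mem_Icc.mpr ⟨by omega, by omega⟩⟩⟩
  calc #((latticeBox d N).filter fun n => realPoint n ∈ posBody Ψ 0 K)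
      ≤ #((latticeBox d N).filter (fun n => realPoint n ∈ posBody Ψ H K) ∪ Finset.univ.biUnion S) :=
        Finset.card_le_card hsub
    _ ≤ #((latticeBox d N).filter fun n => realPoint n ∈ posBody Ψ H K) + #(Finset.univ.biUnion S) :=
        Finset.card_union_le _ _
    _ ≤ _ := by
        refine Nat.add_le_add_left ?_ _
        calc #(Finset.univ.biUnion S) ≤ ∑ i, #(S i) := Finset.card_biUnion_le
          _ ≤ ∑ _i : Fin t, H * (2 * N + 1) ^ (d - 1) := Finset.sum_le_sum fun i _ => hS i
          _ = t * (H * (2 * N + 1) ^ (d - 1)) := by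
              rw [Finset.sum_const, Finset.card_univ, Fintype.card_fin, smul_eq_mul]

/-- The von Mangoldt sum only sees `posBody Ψ 0 K` (`Λ(m) = 0` for `m ≤ 0`).
[cite: GreenTao2010, §4 (Elimination of the archimedean factor)] -/
theorem vonMangoldtSum_posBody_zero (Ψ : Fin t → AffLinForm d) (K : Set (Fin d → ℝ)) (N : ℕ) :
    vonMangoldtSum Ψ (posBody Ψ 0 K) N = vonMangoldtSum Ψ K N := by
  classical
  unfold vonMangoldtSum
  have hsub : (latticeBox d N).filter (fun n => realPoint n ∈ posBody Ψ 0 K) ⊆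
      (latticeBox d N).filter (fun n => realPoint n ∈ K) :=
    Finset.monotone_filter_right _ (fun n _ hn => posBody_subset Ψ 0 K hn)
  rw [← Finset.sum_subset hsub]
  intro n hnA hnA'
  obtain ⟨hnbox, hnK⟩ := Finset.mem_filter.mp hnA
  have hnot : ¬ ∀ i, (0 : ℝ) < (Ψ i).realEval (realPoint n) := fun hall =>
    hnA' (Finset.mem_filter.mpr ⟨hnbox, hnK, hall⟩)
  push Not at hnot
  obtain ⟨i, hi⟩ := hnot
  rw [realEval_realPoint] at hi
  exact prod_intVonMangoldt_eq_zero (i := i) (by exact_mod_cast hi)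

end Literature.NumberTheory.Sieve
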